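/-
Origin: expansion seat `planner-pub-hodgecm-mc-period-1-g6-0`, handover #1097 2026-08-19T06:59Z md5 525b74fa86dabf18fe29e69e0ce9697f (NEW PKG leaf Model/ArchSideInstance, 188 l.: ns HodgeCM.Adelic — def toRegime (regime collapse: regimeEquiv in the anisotropic regime, 1 outside) + toRegime_eq / toRegime_eq_one / coe_toRegime_apply / toRegime_apply_of / toRegime_mem_regimeRat / toRegime_injective; ns HodgeCM.Model — def toLatticeModelG V (tree adelicUnitaryGroup -> (V.latticeModel printFact_unitaryCompact_holds).G via J0(d) + toRegime) + _apply / _mem_Γ / _injective, def archInfOf V : U21 →* (V.latticeModel printFact_unitaryCompact_holds).G (+ _apply, _injective, _injective_of_four_le), def archFinOf V : Subgroup (V.latticeModel printFact_unitaryCompact_holds).G (+ mem_archFinOf_iff), theorem commute_archFinOf_archInfOf V : ∀ x, ∀ k ∈ archFinOf V, Commute k (archInfOf V x), theorem rat_split_archInfOf V : ∀ γ ∈ BallRational.ratImage L ι₁ V.Hm V.sylvesterFrame (sylvesterFrame_J V), ∃ k ∈ archFinOf V, archInfOf V γ * k ∈ (V.latticeModel printFact_unitaryCompact_holds).Γ —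 the four G-side field types of theta-3's ThetaAdelicSide VERBATIM; 4 defs (MonoidHom/Subgroup data, no Prop), 0 records, cites nothing; imports HodgeCM.Model.BallInstance + HodgeCM.Model.Junction.TreeTwins (installed) + row #1096; farm rc 0 / 0 warnings, axioms trio; INSTALL after #1096) (`HOME/mc/pub-hodgecm-mc-period-1-g6/pkg/HodgeCM/Model/ArchSideInstance.lean`, md5 525b74fa, 188 lines);
landed by the gen-12 packager (p-g12) in gate run 36 as `HodgeCM/Model/ArchSideInstance.lean` (verbatim).
-/
/-
Origin: CONSTRUCTION seat `planner-pub-hodgecm-mc-period-1-g6-0` (unit pub-hodgecm-mc-period-1-g6, gen 6 of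
mc-period-1, period lane), 2026-08-19.  NEW additive KERNEL leaf `HodgeCM/Model/ArchSideInstance.lean` (node «S-arch»).
Imports: `HodgeCM.Model.BallInstance` (`HermSpace3.sylvesterFrame`, `sylvesterFrame_J`, `HermSpace3.latticeModel`,
`printFact_unitaryCompact_holds`), the twin junction `HodgeCM.Model.Junction.TreeTwins` (J0(d)/(e): the PKG's
`adelicUnitaryGroup` / `adelicUnitaryRat` ARE the tree's, `rfl`), and the vendored twin of the tree leaf (T2)
`Literature/NumberTheory/Automorphic/UnitaryGroupArchSection.lean` (this seat).
No proof holes, no hypotheses minted, nothing cited: definitions and kernel lemmas only.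
Expected `#print axioms`: {propext, Classical.choice, Quot.sound}.
-/
import Summits.HodgeConjecture.HodgeCM.Model.BallInstance
import Summits.HodgeConjecture.HodgeCM.Model.Junction.TreeTwins
import Literature.NumberTheory.Automorphic.UnitaryGroupArchSection

/-!
# The archimedean side of the theta-space adelic datum — CONSTRUCTED (node «S-arch»)

The v2 sub-binder `S : ThetaAdelicSide V c` of the theta-space input (`Model/ThetaSpaceInputPin`, theta-3 lane)
carries, next to the Weil pair data `P` / `hΓU` (weil / unitary lanes), four G-side fields over the regime model
`G := (V.latticeModel printFact_unitaryCompact_holds).G = ↥(regimeSubgroup L V.Hm)` (`= U(V.Hm)(𝔸_{L⁺})` in PerL's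
anisotropic regime), `Γ := regimeRat L V.Hm` (its rational points):

* `ιinf : U21 →* G` — the archimedean component in the uniform Sylvester frame,
* `Gfin : Subgroup G`, `comm_fin : ∀ x, ∀ k ∈ Gfin, Commute k (ιinf x)`,
* `rat_split : ∀ γ ∈ BallRational.ratImage L ι₁ V.Hm V.sylvesterFrame (sylvesterFrame_J V), ∃ k ∈ Gfin, ιinf γ * k ∈ Γ`.

This file CONSTRUCTS them, with these field types LITERALLY (so that the honest record
`{ P := …, hΓU := …, ιinf := Model.archInfOf V, Gfin := Model.archFinOf V,
   comm_fin := Model.commute_archFinOf_archInfOf V, rat_split := Model.rat_split_archInfOf V }` elaborates with no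
cast), from the tree leaf (T2) `UnitaryGroupArchSection` § 3:

* `Model.archInfOf V := toLatticeModelG V ∘ archSectionU21CM L ι₁ V.Hm V.sylvesterFrame (sylvesterFrame_J V)` — the
  honest archimedean SECTION `U(2,1) ≅ U(V.Hm ⊗_{ι₁} ℂ) ↪ U(V.Hm)(L ⊗ ℝ) ↪ U(V.Hm)(𝔸_{L⁺})` at the place of `ι₁`
  through the frame (`u ↦ (T u T⁻¹ un-twisted at ι₁, 1 at the other places and at the finite adeles)`), read in
  the regime model through `toLatticeModelG V` (= the identity `regimeEquiv` in the anisotropic regime — always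
  the case for E, `HermSpace3.isAnisotropic` — and the trivial map outside it, where nothing is claimed);
* `Model.archFinOf V := (awayFromCM 3 L ι₁ V.Hm).map (toLatticeModelG V)` — the AWAY-FROM-`ι₁` factor
  `Π_{w ≠ w_{ι₁}} U(σ_w V.Hm)(ℂ) × U(V.Hm)(𝔸_{L⁺,f})` (kernel of the `ι₁`-component).  NB (model1-g5 2026-08-19T06:32:17Z
  (4)): this is NOT «the finite-adelic factor» of the pin's docstring whenever `L⁺ ≠ ℚ` — a rational point has
  non-trivial components at the other (compact) archimedean places, which `k` must absorb; the FIELD is a bare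
  `Subgroup` used only through `comm_fin` / `rat_split` (`ThetaAdelicSide.hRat`), so the typing is right and only
  the words differ; a consumer needing the level-structure factor `G_U(𝔸_f)` must not read it off `Gfin`;
* `Model.commute_archFinOf_archInfOf` = (T2) `commute_archSectionU21CM_of_mem_awayFromCM` mapped along
  `toLatticeModelG`; `Model.rat_split_archInfOf` = (T2) `exists_archSectionU21CM_mul_mem_adelicUnitaryRat` (the
  `ι₁`-component of `γ ⊗ 1` in frame coordinates is `γ` itself) + J0(e) + `regimeEquiv_mem_regimeRat_iff` (off
  regime: `1 ∈ Γ`).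

MODEL-N ±0 (kernel).  E is untouched: `S` stays E's data binder; these are the canonical producers of its G-side.
-/

set_option autoImplicit false

noncomputable section

open NumberField
open Literature.Geometry.ComplexHyperbolic.BallModel (U21)
open Literature.NumberTheory.Automorphic
open Literature.AlgebraicGeometry.ShimuraVarieties

namespace HodgeCM

/-! ### The regime collapse `U(H)(𝔸_{L⁺}) →* ↥(regimeSubgroup L H)` -/

namespace Adelic

variable (L : CMField) {n : Type} [Fintype n] [DecidableEq n] (H : Matrix n n L)

open Classical in
/-- **The regime collapse**: the identity `regimeEquiv L H h` onto the regime subgroup when `H` is anisotropic,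
the trivial homomorphism otherwise (outside the regime the regime subgroup is `⊥` and nothing is claimed). -/
def toRegime : adelicUnitaryGroup L H →* ↥(regimeSubgroup L H) :=
  if h : IsAnisotropic L H then (regimeEquiv L H h).toMonoidHom else 1

/-- (Ported verbatim from the HodgeCMPerL package; no docstring in the source.) -/
theorem toRegime_eq (h : IsAnisotropic L H) : toRegime L H = (regimeEquiv L H h).toMonoidHom := dif_pos h

/-- (Ported verbatim from the HodgeCMPerL package; no docstring in the source.) -/
theorem toRegime_eq_one (h : ¬ IsAnisotropic L H) : toRegime L H = 1 := dif_neg h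

/-- In the regime, `toRegime` is the identity on underlying elements. -/
theorem coe_toRegime_apply (h : IsAnisotropic L H) (g : adelicUnitaryGroup L H) :
    ((toRegime L H g : ↥(regimeSubgroup L H)) : adelicUnitaryGroup L H) = g := by
  rw [toRegime_eq L H h]
  rfl

/-- (Ported verbatim from the HodgeCMPerL package; no docstring in the source.) -/
theorem toRegime_apply_of (h : IsAnisotropic L H) (g : adelicUnitaryGroup L H) :
    toRegime L H g = regimeEquiv L H h g := by
  rw [toRegime_eq L H h]
  rfl

/-- `toRegime` maps rational points to rational points of the regime subgroup (in the regime by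
`regimeEquiv_mem_regimeRat_iff`, outside it because `1 ∈ regimeRat`). -/
theorem toRegime_mem_regimeRat {g : adelicUnitaryGroup L H} (hg : g ∈ adelicUnitaryRat L H) :
    toRegime L H g ∈ regimeRat L H := by
  by_cases h : IsAnisotropic L H
  · rw [toRegime_apply_of L H h]
    exact (regimeEquiv_mem_regimeRat_iff L H h g).2 hg
  · rw [toRegime_eq_one L H h, MonoidHom.one_apply]
    exact one_mem _

/-- In the regime `toRegime` is injective. -/
theorem toRegime_injective (h : IsAnisotropic L H) : Function.Injective (toRegime L H) := by
  rw [toRegime_eq L H h]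
  exact (regimeEquiv L H h).injective

end Adelic

namespace Model

variable {L : CMField} {ι₁ : L →+* ℂ} (V : HermSpace3 L ι₁)

/-! ### From the tree's `U(V.Hm)(𝔸_{L⁺})` to the regime model group -/

/-- **The tree's adelic unitary group read in the regime model**: J0(d) (`adelicUnitaryGroupTwin`, the identity)
followed by the regime collapse; typed on `(V.latticeModel printFact_unitaryCompact_holds).G` (`= ↥(regimeSubgroup
L V.Hm)` by `rfl`, `HermSpace3.latticeModel_G`). -/
def toLatticeModelG :
    ↥(Literature.NumberTheory.Automorphic.adelicUnitaryGroup L V.Hm) →*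
      (V.latticeModel printFact_unitaryCompact_holds).G :=
  (Adelic.toRegime L V.Hm).comp (Junction.adelicUnitaryGroupTwin L V.Hm).toMonoidHom

/-- (Ported verbatim from the HodgeCMPerL package; no docstring in the source.) -/
theorem toLatticeModelG_apply (g : ↥(Literature.NumberTheory.Automorphic.adelicUnitaryGroup L V.Hm)) :
    toLatticeModelG V g = Adelic.toRegime L V.Hm (Junction.adelicUnitaryGroupTwin L V.Hm g) := rfl

/-- Rational points go to the model's `Γ`. -/
theorem toLatticeModelG_mem_Γ {g : ↥(Literature.NumberTheory.Automorphic.adelicUnitaryGroup L V.Hm)}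
    (hg : g ∈ Literature.NumberTheory.Automorphic.adelicUnitaryRat L V.Hm) :
    toLatticeModelG V g ∈ (V.latticeModel printFact_unitaryCompact_holds).Γ :=
  Adelic.toRegime_mem_regimeRat L V.Hm ((Junction.adelicUnitaryGroupTwin_mem_rat_iff L V.Hm g).2 hg)

/-- In the regime (`HermSpace3.isAnisotropic`: `4 ≤ [L:ℚ]`) `toLatticeModelG` is injective. -/
theorem toLatticeModelG_injective (h : IsAnisotropic L V.Hm) : Function.Injective (toLatticeModelG V) :=
  (Adelic.toRegime_injective L V.Hm h).comp (Junction.adelicUnitaryGroupTwin L V.Hm).injective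

/-! ### The four G-side fields of `ThetaAdelicSide V c` -/

/-- **`ιinf`, CONSTRUCTED: the archimedean component `U(2,1) →* G_U(𝔸)` in the uniform Sylvester frame** — the
section of (T2) `UnitaryGroupArchSection` at the place of `ι₁` through `V.sylvesterFrame`, read in the regime model.
Off the anisotropic regime (never for E) it is the trivial map by design of `regimeSubgroup`. -/
def archInfOf : U21 →* (V.latticeModel printFact_unitaryCompact_holds).G :=
  (toLatticeModelG V).comp (UnitaryGroup.archSectionU21CM L ι₁ V.Hm V.sylvesterFrame (sylvesterFrame_J V))

/-- (Ported verbatim from the HodgeCMPerL package; no docstring in the source.) -/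
theorem archInfOf_apply (x : U21) :
    archInfOf V x = toLatticeModelG V (UnitaryGroup.archSectionU21CM L ι₁ V.Hm V.sylvesterFrame (sylvesterFrame_J V) x) :=
  rfl

/-- In the regime `archInfOf V` is injective (an honest inclusion of `U(2,1)`). -/
theorem archInfOf_injective (h : IsAnisotropic L V.Hm) : Function.Injective (archInfOf V) :=
  (toLatticeModelG_injective V h).comp
    (UnitaryGroup.archSectionU21CM_injective L ι₁ V.Hm V.sylvesterFrame (sylvesterFrame_J V))

/-- In PerL's regime `4 ≤ [L:ℚ]` (`HermSpace3.isAnisotropic`) `archInfOf V` is injective. -/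
theorem archInfOf_injective_of_four_le (h4 : 4 ≤ Module.finrank ℚ L) : Function.Injective (archInfOf V) :=
  archInfOf_injective V (V.isAnisotropic h4)

/-- **`Gfin`, CONSTRUCTED: the away-from-`ι₁` factor** `Π_{w ≠ w_{ι₁}} U(σ_w V.Hm)(ℂ) × U(V.Hm)(𝔸_{L⁺,f})` of
`G_U(𝔸)` (image of (T2) `awayFromCM 3 L ι₁ V.Hm = ker (ι₁-component)`), read in the regime model. -/
def archFinOf : Subgroup (V.latticeModel printFact_unitaryCompact_holds).G :=
  (UnitaryGroup.awayFromCM 3 L ι₁ V.Hm).map (toLatticeModelG V)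

/-- (Ported verbatim from the HodgeCMPerL package; no docstring in the source.) -/
theorem mem_archFinOf_iff (k : (V.latticeModel printFact_unitaryCompact_holds).G) :
    k ∈ archFinOf V ↔ ∃ k₀ ∈ UnitaryGroup.awayFromCM 3 L ι₁ V.Hm, toLatticeModelG V k₀ = k :=
  Subgroup.mem_map

/-- **`comm_fin`, PROVED: the away-from-`ι₁` factor commutes with the archimedean component.** -/
theorem commute_archFinOf_archInfOf : ∀ (x : U21), ∀ k ∈ archFinOf V, Commute k (archInfOf V x) := by
  rintro x _ ⟨k, hk, rfl⟩
  rw [archInfOf_apply]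
  exact (UnitaryGroup.commute_archSectionU21CM_of_mem_awayFromCM L ι₁ V.Hm V.sylvesterFrame (sylvesterFrame_J V)
    x hk).map (toLatticeModelG V)

/-- **`rat_split`, PROVED: every rational point `γ ∈ U(V)(L⁺) ⊂ U(2,1)` (uniform frame) is, up to an
away-from-`ι₁` corrector, a point of `Γ = G_U(L⁺)` of the regime model** — `γ ⊗ 1 = archInfOf γ · k⁻¹`-style
splitting of (T2) `exists_archSectionU21CM_mul_mem_adelicUnitaryRat`, transported by `toLatticeModelG` (J0(e);
off regime trivially, `1 ∈ Γ`). -/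
theorem rat_split_archInfOf :
    ∀ γ ∈ BallRational.ratImage L ι₁ V.Hm V.sylvesterFrame (sylvesterFrame_J V),
      ∃ k ∈ archFinOf V, archInfOf V γ * k ∈ (V.latticeModel printFact_unitaryCompact_holds).Γ := by
  intro γ hγ
  obtain ⟨k, hk, hmem⟩ :=
    UnitaryGroup.exists_archSectionU21CM_mul_mem_adelicUnitaryRat L ι₁ V.Hm V.sylvesterFrame (sylvesterFrame_J V) hγ
  refine ⟨toLatticeModelG V k, Subgroup.mem_map_of_mem (toLatticeModelG V) hk, ?_⟩
  rw [archInfOf_apply, ← map_mul]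
  exact toLatticeModelG_mem_Γ V hmem

end Model

end HodgeCM

end
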